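import Summits.KontsevichZagierPeriods.KontsevichZagierPeriods.Theorems.SoloBlindHomogeneous
import HarnessLib

/-!
# Homogeneous sectors in two logarithms: `H_k(μ, ν)` by Gelfond–Schneider

Solo programme `solo-KontsevichZagierPeriods-blind`, session 5.

`SoloBlindHomogeneous` decided the Kontsevich–Zagier conjecture on the homogeneous degree-`k`
forms in `(x_π, ℓ(μ))`, using `π / log μ ∉ ℚ̄` (Gelfond–Schneider with the exponent `iπ/log μ`).
The same dehomogenisation works for two logarithms: if `μ, ν > 1` are real algebraic and
`log μ / log ν` is irrational, Gelfond–Schneider (`μ = ν^{log μ / log ν}`) makes the ratio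
transcendental (`transcendental_log_div_log`), so the monomials `(log μ)^a (log ν)^{k-a}`,
`a = 0..k`, are linearly independent over `K₀ = ℚ̄ ∩ ℝ` and the `K₀`-span `H_k(μ, ν)` of the
classes `ℓ(μ)^a ℓ(ν)^{k-a}` in `Q` is eval-injective: **KZ holds for every pair of integral
representations with classes in `H_k(μ, ν)`** (`kz_homSector₂`).

Worked instance `(μ, ν) = (3, 2)` (`2^m ≠ 3^n`, `irrational_log_three_div_log_two`): the products
of log cells `L₃ × L₂`, `L₂ × L₂`, `L₃ × L₃`, and — since `ℓ(6) = ℓ(2) + ℓ(3)`,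
`ℓ(18) = ℓ(2) + 2ℓ(3)` in `Q` — also `L₆ × L₆`, `L₂ × L₁₈` lie in `H₂(3, 2)`; e.g. the identity
`log² 6 = log 2 · log 18 + log² 3` becomes the relation `[L₆ × L₆] = [L₂ × L₁₈] + [L₃ × L₃]`
between three two-dimensional representations (`logSix_sq_mem_relations`), decided on the sector.

Honest scope: as for `H_k(μ)`, only HOMOGENEOUS forms of one degree (inhomogeneous relations among
two logarithms are four-exponentials territory), and only two logarithms (three would need their
homogeneous algebraic independence).
-/

noncomputable section

namespace Summit.KontsevichZagierPeriods.KontsevichZagierPeriods.Theorems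

open Set MeasureTheory
open Literature.NumberTheory.Transcendental
open Literature.NumberTheory.Transcendental.KZ

namespace SoloBlind

/-! ## Gelfond–Schneider ⇒ an irrational ratio of logarithms is transcendental -/

/-- **`log μ / log ν ∉ ℚ ⇒ log μ / log ν ∉ ℚ̄`** for real algebraic `μ, ν > 0`, `ν ≠ 1`: otherwise
`β = log μ / log ν` is algebraic irrational, `e^{log ν} = ν` is algebraic, and Gelfond–Schneider
makes `e^{β log ν} = μ` transcendental. -/
theorem transcendental_log_div_log {μ ν : ℝ} (hμ : IsAlgebraic ℚ μ) (hν : IsAlgebraic ℚ ν)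
    (h0μ : 0 < μ) (h0ν : 0 < ν) (h1 : ν ≠ 1) (hirr : Irrational (Real.log μ / Real.log ν)) :
    Transcendental ℚ (Real.log μ / Real.log ν) := by
  have hL : Real.log ν ≠ 0 := Real.log_ne_zero_of_pos_of_ne_one h0ν h1
  intro hτ
  set β : ℂ := ((Real.log μ / Real.log ν : ℝ) : ℂ) with hβdef
  have hβ : IsAlgebraic ℚ β := hτ.algebraMap (A := ℂ)
  have hβq : β ∉ Set.range ((↑) : ℚ → ℂ) := by
    rintro ⟨q, hq⟩
    refine hirr ⟨q, ?_⟩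
    have h := congrArg Complex.re hq
    simpa [hβdef] using h
  have hexp : Complex.exp ((Real.log ν : ℝ) : ℂ) = (ν : ℂ) := by
    rw [← Complex.ofReal_exp, Real.exp_log h0ν]
  have key : β * (Real.log ν : ℂ) = ((Real.log μ : ℝ) : ℂ) := by
    rw [hβdef, ← Complex.ofReal_mul, div_mul_cancel₀ _ hL]
  have hT := gelfond_schneider_holds (hν.algebraMap (A := ℂ)) hβ hβq hexp
    (Complex.ofReal_ne_zero.mpr hL)
  rw [key, ← Complex.ofReal_exp, Real.exp_log h0μ] at hT
  exact hT (hμ.algebraMap (A := ℂ))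

/-- `log 3 / log 2` is irrational (`3ⁿ = 2ᵐ` is impossible for `n ≥ 1` by parity). -/
theorem irrational_log_three_div_log_two : Irrational (Real.log 3 / Real.log 2) := by
  have h2 : 0 < Real.log 2 := Real.log_pos (by norm_num)
  have h3 : 0 < Real.log 3 := Real.log_pos (by norm_num)
  refine (irrational_iff_ne_rational _).mpr fun a b hb h => ?_
  have hb' : (b : ℝ) ≠ 0 := Int.cast_ne_zero.mpr hb
  have e : (b : ℝ) * Real.log 3 = a * Real.log 2 := by
    rw [div_eq_div_iff h2.ne' hb'] at h
    linarith
  have e' : (b.natAbs : ℝ) * Real.log 3 = (a.natAbs : ℝ) * Real.log 2 := by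
    have habs := congrArg abs e
    rw [abs_mul, abs_mul, abs_of_pos h3, abs_of_pos h2] at habs
    rwa [Nat.cast_natAbs, Nat.cast_natAbs, Int.cast_abs, Int.cast_abs]
  have hn : b.natAbs ≠ 0 := Int.natAbs_ne_zero.mpr hb
  have hm : a.natAbs ≠ 0 := by
    intro hm
    rw [hm, Nat.cast_zero, zero_mul] at e'
    exact (mul_pos (by positivity : (0:ℝ) < b.natAbs) h3).ne' e'
  have key : (3:ℝ) ^ b.natAbs = (2:ℝ) ^ a.natAbs := by
    apply Real.log_injOn_pos (Set.mem_Ioi.mpr (by positivity)) (Set.mem_Ioi.mpr (by positivity))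
    rw [Real.log_pow, Real.log_pow, e']
  have key' : 3 ^ b.natAbs = 2 ^ a.natAbs := by exact_mod_cast key
  have hE : Even (2 ^ a.natAbs) := (Nat.even_pow' hm).mpr even_two
  rw [← key'] at hE
  exact Nat.not_even_iff_odd.mpr (Odd.pow (by decide : Odd 3)) hE

/-! ## The sectors `H_k(μ, ν)` -/

/-- The degree-`k` monomial classes `ℓ(μ)^a · ℓ(ν)^(k-a)`, `a = 0, …, k`. -/
def homGen₂ (μ ν : ℝ) (k : ℕ) (a : Fin (k + 1)) : Q := ell μ ^ (a : ℕ) * ell ν ^ (k - (a : ℕ))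

/-- Values of the two-log monomial classes. -/
theorem evalQ_homGen₂ {μ ν : ℝ} (hμ : IsAlgebraic ℚ μ) (hν : IsAlgebraic ℚ ν) (h1μ : 1 ≤ μ)
    (h1ν : 1 ≤ ν) (k : ℕ) (a : Fin (k + 1)) :
    evalQ (homGen₂ μ ν k a) = Real.log μ ^ (a : ℕ) * Real.log ν ^ (k - (a : ℕ)) := by
  rw [homGen₂, map_mul, map_pow, map_pow, evalQ_ell hμ h1μ, evalQ_ell hν h1ν]

/-- **The two-log homogeneous sector** `H_k(μ, ν)`: formal combinations whose class is a
homogeneous degree-`k` form in `ℓ(μ), ℓ(ν)` over `K₀`. -/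
abbrev homSector₂ (μ ν : ℝ) (k : ℕ) : AddSubgroup FormalRep := modSector (homGen₂ μ ν k)

/-- The values of the generators of `H_k(μ, ν)` are `K₀`-independent (Gelfond–Schneider). -/
theorem linearIndependent_evalQ_homGen₂ {μ ν : ℝ} (hμ : IsAlgebraic ℚ μ) (hν : IsAlgebraic ℚ ν)
    (h1μ : 1 < μ) (h1ν : 1 < ν) (hirr : Irrational (Real.log μ / Real.log ν)) (k : ℕ) :
    LinearIndependent K₀ fun a => evalQ (homGen₂ μ ν k a) := by
  have h := linearIndependent_monomials (Real.log_pos h1ν).ne'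
    (transcendental_log_div_log hμ hν (by linarith) (by linarith) h1ν.ne' hirr) k
  have hfun : (fun a => evalQ (homGen₂ μ ν k a)) =
      fun a : Fin (k + 1) => Real.log μ ^ (a : ℕ) * Real.log ν ^ (k - (a : ℕ)) := by
    funext a
    exact evalQ_homGen₂ hμ hν h1μ.le h1ν.le k a
  rw [hfun]
  exact h

/-- **Kernel form: KZ on `H_k(μ, ν)`.** -/
theorem homSector₂_kernel {μ ν : ℝ} (hμ : IsAlgebraic ℚ μ) (hν : IsAlgebraic ℚ ν) (h1μ : 1 < μ)
    (h1ν : 1 < ν) (hirr : Irrational (Real.log μ / Real.log ν)) {k : ℕ} {z : FormalRep}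
    (hz : z ∈ homSector₂ μ ν k) (h0 : eval z = 0) : z ∈ relations :=
  modSector_kernel (linearIndependent_evalQ_homGen₂ hμ hν h1μ h1ν hirr k) hz h0

/-- **The Kontsevich–Zagier conjecture holds on every two-log homogeneous sector `H_k(μ, ν)`**
(`μ, ν > 1` real algebraic, `log μ / log ν ∉ ℚ`). -/
theorem kz_homSector₂ {μ ν : ℝ} (hμ : IsAlgebraic ℚ μ) (hν : IsAlgebraic ℚ ν) (h1μ : 1 < μ)
    (h1ν : 1 < ν) (hirr : Irrational (Real.log μ / Real.log ν)) {k n m : ℕ} (r : IntegralRep n)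
    (r' : IntegralRep m) (hr : of r ∈ homSector₂ μ ν k) (hr' : of r' ∈ homSector₂ μ ν k)
    (hv : r.value = r'.value) : Equivalent r r' :=
  kz_modSector (linearIndependent_evalQ_homGen₂ hμ hν h1μ h1ν hirr k) r r' hr hr' hv

/-! ## The instance `(μ, ν) = (3, 2)` -/

/-- `L_n = [[1,n], dx/x]`, the unit log cell of `log n`. -/
def natLogCell (n : ℕ) : IntegralRep 1 := logCell 1 n isAlgebraic_one (isAlgebraic_nat n)

/-- `[L_n] = ℓ(n)`. -/
theorem mkQ_natLogCell (n : ℕ) : mkQ (of (natLogCell n)) = ell n :=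
  (ell_eq (isAlgebraic_nat n)).symm

/-- `value L_n = log n` (`n ≥ 1`). -/
theorem natLogCell_value {n : ℕ} (hn : 1 ≤ n) : (natLogCell n).value = Real.log n := by
  rw [natLogCell, value_logCell (by exact_mod_cast hn), one_mul]

/-- `[L_p × L_q] = ℓ(p) ℓ(q)`. -/
theorem mkQ_natLogCell_prod (p q : ℕ) :
    mkQ (of ((natLogCell p).prod (natLogCell q))) = ell p * ell q := by
  rw [← of_mul_of, mkQ_mul, mkQ_natLogCell, mkQ_natLogCell]

/-- The three generators of `H₂(3, 2)`: `ℓ(2)²`, `ℓ(3)ℓ(2)`, `ℓ(3)²`. -/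
theorem homGen₂_three_two :
    homGen₂ 3 2 2 0 = ell 2 ^ 2 ∧ homGen₂ 3 2 2 1 = ell 3 * ell 2 ∧
      homGen₂ 3 2 2 2 = ell 3 ^ 2 := by
  refine ⟨?_, ?_, ?_⟩ <;> simp [homGen₂]

/-- A homogeneous quadratic form in `ℓ(3), ℓ(2)` with natural coefficients lies in the span. -/
theorem quadForm_mem_span (c₀ c₁ c₂ : ℕ) :
    c₀ • ell 2 ^ 2 + c₁ • (ell 3 * ell 2) + c₂ • ell 3 ^ 2 ∈
      Submodule.span K₀ (Set.range (homGen₂ 3 2 2)) := by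
  obtain ⟨h0, h1, h2⟩ := homGen₂_three_two
  refine add_mem (add_mem ?_ ?_) ?_
  · rw [← h0]; exact nsmul_mem (Submodule.subset_span (mem_range_self _)) _
  · rw [← h1]; exact nsmul_mem (Submodule.subset_span (mem_range_self _)) _
  · rw [← h2]; exact nsmul_mem (Submodule.subset_span (mem_range_self _)) _

/-- `ℓ(6) = ℓ(2) + ℓ(3)` in `Q` (Baker-free: the rank-one log calculus of
`SoloBlindBoxGenerators`). -/
theorem ell_six : ell 6 = ell 2 + ell 3 := by
  have h := ell_eq_sum_smul (μ := 6) (by simpa using isAlgebraic_nat (R := ℚ) (A := ℝ) 6)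
    (by norm_num) ![(2:ℝ), 3]
    (fun k => by
      fin_cases k
      · simpa using isAlgebraic_nat (R := ℚ) (A := ℝ) 2
      · simpa using isAlgebraic_nat (R := ℚ) (A := ℝ) 3)
    (fun k => by fin_cases k <;> norm_num) ![(1:ℚ), 1] (by
      rw [Fin.sum_univ_two]
      simp only [Matrix.cons_val_zero, Matrix.cons_val_one, Matrix.cons_val_fin_one,
        Rat.cast_one, one_mul]
      rw [← Real.log_mul (by norm_num) (by norm_num)]
      norm_num)
  rw [h, Fin.sum_univ_two]
  simp

/-- `ℓ(18) = ℓ(2) + 2 ℓ(3)` in `Q`. -/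
theorem ell_eighteen : ell 18 = ell 2 + 2 • ell 3 := by
  have h := ell_eq_sum_smul (μ := 18) (by simpa using isAlgebraic_nat (R := ℚ) (A := ℝ) 18)
    (by norm_num) ![(2:ℝ), 3]
    (fun k => by
      fin_cases k
      · simpa using isAlgebraic_nat (R := ℚ) (A := ℝ) 2
      · simpa using isAlgebraic_nat (R := ℚ) (A := ℝ) 3)
    (fun k => by fin_cases k <;> norm_num) ![(1:ℚ), 2] (by
      rw [Fin.sum_univ_two]
      simp only [Matrix.cons_val_zero, Matrix.cons_val_one, Matrix.cons_val_fin_one,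
        Rat.cast_one, one_mul, Rat.cast_ofNat]
      rw [show (18:ℝ) = 2 * 3 ^ 2 by norm_num, Real.log_mul (by norm_num) (by norm_num),
        Real.log_pow]
      norm_num)
  rw [h, Fin.sum_univ_two]
  simp [ofNat_smul_eq_nsmul]

/-- `L₃ × L₂ ∈ H₂(3, 2)`. -/
theorem of_logThree_logTwo_mem : of ((natLogCell 3).prod (natLogCell 2)) ∈ homSector₂ 3 2 2 := by
  rw [mem_modSector, mkQ_natLogCell_prod]
  simpa using quadForm_mem_span 0 1 0

/-- `L₃ × L₃ ∈ H₂(3, 2)`. -/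
theorem of_logThree_sq_mem : of ((natLogCell 3).prod (natLogCell 3)) ∈ homSector₂ 3 2 2 := by
  rw [mem_modSector, mkQ_natLogCell_prod, ← sq]
  simpa using quadForm_mem_span 0 0 1

/-- `L₂ × L₂ ∈ H₂(3, 2)`. -/
theorem of_logTwo_sq_mem : of ((natLogCell 2).prod (natLogCell 2)) ∈ homSector₂ 3 2 2 := by
  rw [mem_modSector, mkQ_natLogCell_prod, ← sq]
  simpa using quadForm_mem_span 1 0 0

/-- `L₆ × L₆ ∈ H₂(3, 2)`: its class is `(ℓ(2) + ℓ(3))² = ℓ(2)² + 2 ℓ(3)ℓ(2) + ℓ(3)²`. -/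
theorem of_logSix_sq_mem : of ((natLogCell 6).prod (natLogCell 6)) ∈ homSector₂ 3 2 2 := by
  rw [mem_modSector, mkQ_natLogCell_prod, Nat.cast_ofNat, ell_six]
  have e : (ell 2 + ell 3) * (ell 2 + ell 3) =
      1 • ell 2 ^ 2 + 2 • (ell 3 * ell 2) + 1 • ell 3 ^ 2 := by ring
  rw [e]
  exact quadForm_mem_span 1 2 1

/-- `L₂ × L₁₈ ∈ H₂(3, 2)`: its class is `ℓ(2)(ℓ(2) + 2ℓ(3)) = ℓ(2)² + 2 ℓ(3)ℓ(2)`. -/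
theorem of_logTwo_logEighteen_mem :
    of ((natLogCell 2).prod (natLogCell 18)) ∈ homSector₂ 3 2 2 := by
  rw [mem_modSector, mkQ_natLogCell_prod, Nat.cast_ofNat, Nat.cast_ofNat, ell_eighteen]
  have e : ell 2 * (ell 2 + 2 • ell 3) = 1 • ell 2 ^ 2 + 2 • (ell 3 * ell 2) + 0 • ell 3 ^ 2 := by
    ring
  rw [e]
  exact quadForm_mem_span 1 2 0

/-- **`log² 6 = log 2 · log 18 + log² 3` inside the KZ rules**: the relation
`[L₆ × L₆] - [L₂ × L₁₈] - [L₃ × L₃] ∈ relations` among three two-dimensional representations,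
decided on the Gelfond–Schneider sector `H₂(3, 2)`. -/
theorem logSix_sq_mem_relations :
    of ((natLogCell 6).prod (natLogCell 6)) - of ((natLogCell 2).prod (natLogCell 18)) -
      of ((natLogCell 3).prod (natLogCell 3)) ∈ relations := by
  refine homSector₂_kernel (isAlgebraic_nat 3) (isAlgebraic_nat 2)
    (by norm_num) (by norm_num) irrational_log_three_div_log_two
    (sub_mem (sub_mem of_logSix_sq_mem of_logTwo_logEighteen_mem) of_logThree_sq_mem) ?_
  rw [map_sub, map_sub, eval_of, eval_of, eval_of, IntegralRep.value_prod,
    IntegralRep.value_prod, IntegralRep.value_prod, natLogCell_value (by norm_num),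
    natLogCell_value (by norm_num), natLogCell_value (by norm_num),
    natLogCell_value (by norm_num)]
  have h6 : Real.log ((6 : ℕ) : ℝ) = Real.log 2 + Real.log 3 := by
    rw [show ((6 : ℕ) : ℝ) = 2 * 3 by norm_num, Real.log_mul (by norm_num) (by norm_num)]
  have h18 : Real.log ((18 : ℕ) : ℝ) = Real.log 2 + 2 * Real.log 3 := by
    rw [show ((18 : ℕ) : ℝ) = 2 * 3 ^ 2 by norm_num, Real.log_mul (by norm_num) (by norm_num),
      Real.log_pow]
    norm_num
  rw [h6, h18, show ((2 : ℕ) : ℝ) = 2 by norm_num, show ((3 : ℕ) : ℝ) = 3 by norm_num]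
  ring

/-- **KZ for `L₃ × L₂` against `H₂(3, 2)`**: any representation in the sector with period
`log 2 · log 3` is KZ-equivalent to `L₃ × L₂`. -/
theorem kz_logThree_logTwo {m : ℕ} (r' : IntegralRep m) (hr' : of r' ∈ homSector₂ 3 2 2)
    (hv : r'.value = Real.log 3 * Real.log 2) :
    Equivalent ((natLogCell 3).prod (natLogCell 2)) r' :=
  kz_homSector₂ (isAlgebraic_nat 3) (isAlgebraic_nat 2) (by norm_num)
    (by norm_num) irrational_log_three_div_log_two _ r' of_logThree_logTwo_mem hr'
    (by rw [IntegralRep.value_prod, natLogCell_value (by norm_num),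
      natLogCell_value (by norm_num), hv]; push_cast; ring)

end SoloBlind

end Summit.KontsevichZagierPeriods.KontsevichZagierPeriods.Theorems

end
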